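import Literature.NumberTheory.Transcendental.KZDirichletCharts

/-!
# `BetaProductSector` (stmt-KontsevichZagierPeriods-3898), line `registered` (v3) — stub `stub_quadStep`,
# part 1: the symmetric chart of the wedge

The QUADRATIC MOVE "QUAD" of the line (`B(x,y)·B(x+½,y) = 2·B(2x,2y)·B(½,y)`, the (2,2) shadow of Gauss's
quadratic transformation, Andrews–Askey–Roy 1999 Thm 3.1.3) is realised inside the Kontsevich–Zagier calculus
of moves by the chain `box ∼ wedge ⊔ wedge' ∼ (fold by the coordinate swap) ∼ [wedge, symmetrised integrand]
∼ (symmetric chart) ∼ [simplex, …] ∼ (linear Dirichlet chart) ∼ box` (parts 2 and 3). THIS file supplies the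
only genuinely new two-dimensional change of variables of that chain, the **symmetric chart**

  `Φ(σ, τ) = (σ τ, τ − σ)` of the open wedge `{0 < σ < τ < 1}` ONTO the open simplex `{p > 0, m > 0, p + m < 1}`,

a `ℚ`-polynomial map with `|det DΦ| = σ + τ`, injective on the wedge (`(σ + τ)² = m² + 4p`), onto (inverse
`σ, τ = (√(m² + 4p) ∓ m)/2`), packaged exactly like the Dirichlet charts of `KZDirichletCharts.lean`
(`KZ.exists_dirichletPolarChart`), together with the key polynomial identity
`(1 − στ)² − (τ − σ)² = (1 − σ²)(1 − τ²)` behind the pull-back. Everything is proved; no `def`, no named fact.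

References: Kontsevich–Zagier 2001 §1.2 rule (2); Andrews–Askey–Roy 1999 Thm 3.1.3.
-/

noncomputable section

open MeasureTheory Set
open Literature.ModelTheory.ExponentialFields (IsSemialgebraic)

namespace Summit.KontsevichZagierPeriods.FermatIsogeny.BetaProductSectorStubs

open Literature.NumberTheory.Transcendental
open Literature.NumberTheory.Transcendental.KZ

namespace QuadStep

/-- The open wedge `{0 < σ < τ < 1}` (upper half of the open box `(0,1)²` cut by the diagonal) is
`ℚ`-semialgebraic: three strict polynomial inequalities. [folklore] -/
theorem isSemialgebraic_wedge :
    IsSemialgebraic ℚ {z : Fin 2 → ℝ | 0 < z 0 ∧ z 0 < z 1 ∧ z 1 < 1} := by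
  have h := KZ.isSemialgebraic_setOf_forall_aeval_pos
    ![MvPolynomial.X 0, MvPolynomial.X 1 - MvPolynomial.X 0, (1 - MvPolynomial.X 1 : MvPolynomial (Fin 2) ℚ)]
  convert h using 1
  ext x
  simp only [mem_setOf_eq, Fin.forall_fin_succ, Matrix.cons_val_zero, Matrix.cons_val_succ, map_sub,
    map_one, MvPolynomial.aeval_X]
  constructor
  · rintro ⟨h0, h1, h2⟩; exact ⟨h0, by linarith, by linarith, fun i => Fin.elim0 i⟩
  · rintro ⟨h0, h1, h2, -⟩; exact ⟨h0, by linarith, by linarith⟩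

/-- The key identity of the quadratic move: in the symmetric functions `p = στ`, `m = τ − σ` one has
`(1 − p)² − m² = (1 − σ²)(1 − τ²)`. [folklore] -/
theorem quad_key_identity (s t : ℝ) :
    (1 - s * t) ^ 2 - (t - s) ^ 2 = (1 - s ^ 2) * (1 - t ^ 2) := by
  ring

/-- **The symmetric chart `Φ(σ,τ) = (στ, τ − σ)`** of the open simplex `{p > 0, m > 0, p + m < 1}` by the
open wedge `{0 < σ < τ < 1}`: a `ℚ`-polynomial map, differentiable with `|det DΦ| = σ + τ`, injective on the
wedge (`(σ+τ)² = m² + 4p` pins `σ + τ`, and `τ − σ = m`) and ONTO the simplex (inverse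
`σ = (√(m²+4p) − m)/2`, `τ = (√(m²+4p) + m)/2`; `τ < 1 ⇔ p < 1 − m`). [folklore] -/
theorem stub_quadSymChart : ∃ (Φ : (Fin 2 → ℝ) → (Fin 2 → ℝ)) (Φ' : (Fin 2 → ℝ) → (Fin 2 → ℝ) →L[ℝ] (Fin 2 → ℝ)), (∀ z, Φ z 0 = z 0 * z 1) ∧ (∀ z, Φ z 1 = z 1 - z 0) ∧ Literature.NumberTheory.Transcendental.IsSemialgebraicMapOn ℚ {z : Fin 2 → ℝ | 0 < z 0 ∧ z 0 < z 1 ∧ z 1 < 1} Φ ∧ (∀ z, HasFDerivAt Φ (Φ' z) z) ∧ Set.InjOn Φ {z : Fin 2 → ℝ | 0 < z 0 ∧ z 0 < z 1 ∧ z 1 < 1} ∧ Φ '' {z : Fin 2 → ℝ | 0 < z 0 ∧ z 0 < z 1 ∧ z 1 < 1} = {z : Fin 2 → ℝ | 0 < z 0 ∧ 0 < z 1 ∧ z 0 + z 1 < 1} ∧ (∀ z ∈ {z : Fin 2 → ℝ | 0 < z 0 ∧ z 0 < z 1 ∧ z 1 < 1}, |(Φ' z).det| = z 0 + z 1) :=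 by
  set Φ : (Fin 2 → ℝ) → (Fin 2 → ℝ) := fun z => ![z 0 * z 1, z 1 - z 0] with hΦ
  set Φ' : (Fin 2 → ℝ) → (Fin 2 → ℝ) →L[ℝ] (Fin 2 → ℝ) :=
    fun z => LinearMap.toContinuousLinearMap (Matrix.toLin' !![z 1, z 0; -1, 1]) with hΦ'
  have hΦ0 : ∀ z, Φ z 0 = z 0 * z 1 := fun z => rfl
  have hΦ1 : ∀ z, Φ z 1 = z 1 - z 0 := fun z => rfl
  have hΦ'0 : ∀ z v : Fin 2 → ℝ, Φ' z v 0 = z 1 * v 0 + z 0 * v 1 := by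
    intro z v
    change Matrix.toLin' !![z 1, z 0; -1, 1] v 0 = _
    rw [Matrix.toLin'_apply]
    simp [Matrix.mulVec, dotProduct, Fin.sum_univ_two]
  have hΦ'1 : ∀ z v : Fin 2 → ℝ, Φ' z v 1 = (-1) * v 0 + 1 * v 1 := by
    intro z v
    change Matrix.toLin' !![z 1, z 0; -1, 1] v 1 = _
    rw [Matrix.toLin'_apply]
    simp [Matrix.mulVec, dotProduct, Fin.sum_univ_two]
  have hdet : ∀ z, (Φ' z).det = z 0 + z 1 := by
    intro z
    change LinearMap.det (Matrix.toLin' !![z 1, z 0; -1, 1]) = _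
    rw [LinearMap.det_toLin', Matrix.det_fin_two]
    simp
    ring
  have hderiv : ∀ z, HasFDerivAt Φ (Φ' z) z := by
    intro z
    have h0 : HasFDerivAt (fun y : Fin 2 → ℝ => y 0)
        (ContinuousLinearMap.proj (R := ℝ) (φ := fun _ : Fin 2 => ℝ) 0) z := hasFDerivAt_apply 0 z
    have h1 : HasFDerivAt (fun y : Fin 2 → ℝ => y 1)
        (ContinuousLinearMap.proj (R := ℝ) (φ := fun _ : Fin 2 => ℝ) 1) z := hasFDerivAt_apply 1 z
    rw [hasFDerivAt_pi']
    refine Fin.forall_fin_two.mpr ⟨?_, ?_⟩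
    · have hf : (fun y : Fin 2 → ℝ => Φ y 0) = fun y => y 0 * y 1 := funext fun y => rfl
      rw [hf]
      refine (h0.mul h1).congr_fderiv (ContinuousLinearMap.ext fun v => ?_)
      simp [hΦ'0]
      ring
    · have hf : (fun y : Fin 2 → ℝ => Φ y 1) = fun y => y 1 - y 0 := funext fun y => rfl
      rw [hf]
      refine (h1.sub h0).congr_fderiv (ContinuousLinearMap.ext fun v => ?_)
      simp [hΦ'1]
      ring
  refine ⟨Φ, Φ', hΦ0, hΦ1, ?_, hderiv, ?_, ?_, fun z hz => ?_⟩
  · convert isSemialgebraicMapOn_aeval isSemialgebraic_wedge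
      ![MvPolynomial.X 0 * MvPolynomial.X 1, MvPolynomial.X 1 - MvPolynomial.X 0] using 2 with z
    funext i
    fin_cases i
    · simp [hΦ0]
    · simp [hΦ1]
  · intro x hx y hy hxy
    have e0 := congrFun hxy 0
    have e1 := congrFun hxy 1
    simp only [hΦ0, hΦ1] at e0 e1
    have hpos : 0 < x 0 + y 1 := by
      have := hx.1; have := hy.1; have := hy.2.1
      linarith
    have hprod : (x 0 - y 0) * (x 0 + y 1) = 0 := by linear_combination e0 - (x 0) * e1
    have h0 : x 0 = y 0 := by
      rcases mul_eq_zero.1 hprod with h | h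
      · linarith
      · linarith
    have h1 : x 1 = y 1 := by linarith
    funext i
    fin_cases i
    · exact h0
    · exact h1
  · ext y
    constructor
    · rintro ⟨z, ⟨h0, h1, h2⟩, rfl⟩
      simp only [mem_setOf_eq, hΦ0, hΦ1]
      have hz1 : 0 < z 1 := by linarith
      refine ⟨mul_pos h0 hz1, by linarith, ?_⟩
      nlinarith [mul_pos (sub_pos.2 h2) (by linarith : (0:ℝ) < 1 + z 0)]
    · rintro ⟨hy0, hy1, hy2⟩
      have hD : 0 ≤ y 1 ^ 2 + 4 * y 0 := by positivity
      set d : ℝ := Real.sqrt (y 1 ^ 2 + 4 * y 0) with hd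
      have hd2 : d ^ 2 = y 1 ^ 2 + 4 * y 0 := Real.sq_sqrt hD
      have hdm : y 1 < d := by
        rw [hd, Real.lt_sqrt hy1.le]
        linarith
      have hd1 : d < 2 - y 1 := by
        rw [hd, Real.sqrt_lt' (by linarith : (0:ℝ) < 2 - y 1)]
        nlinarith
      refine ⟨![(d - y 1) / 2, (d + y 1) / 2], ⟨?_, ?_, ?_⟩, ?_⟩
      · change 0 < (d - y 1) / 2
        linarith
      · change (d - y 1) / 2 < (d + y 1) / 2
        linarith
      · change (d + y 1) / 2 < 1
        linarith
      · funext i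
        fin_cases i
        · change (d - y 1) / 2 * ((d + y 1) / 2) = y 0
          linear_combination hd2 / 4
        · change (d + y 1) / 2 - (d - y 1) / 2 = y 1
          ring
  · rw [hdet, abs_of_pos (by have := hz.1; have := hz.2.1; linarith)]

end QuadStep

end Summit.KontsevichZagierPeriods.FermatIsogeny.BetaProductSectorStubs

end
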